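import Summits.BirchSwinnertonDyer.Rank1Residual.X11b.BDPRouteControlTamagawa
import Summits.BirchSwinnertonDyer.Rank1Residual.X11b.BDPRouteRecordDelta
import HarnessLib

/-!
# Class X11b, route "BDP + converse-theorem engine + Kolyvagin" (p2): the control input of the
# statement of record SPLIT by the erratum's (iv) — on the (iv)-part it is ONE Selmer cardinality
# bound (Cas18 (3.2.1)+(calcul), `≤`), the bad-place kernels being kernel theorems
# (cell `b2b-bsdres`, sub-cell `multr1-p2`, gen 14)

HONEST FRAMING (verbatim, cell `b2b-bsdres`): the goal of the cell is to DELETE the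
COMBINATION-SHAPED residual classes for ALL analytic-rank `≤ 1` curves over `ℚ` — "full BSD
formula for every rank `≤ 1` curve in class `C`" assembled STRICTLY from published theorems — so
that the rank-`≤ 1` remainder becomes exactly the CONSTRUCTION-SHAPED classes, which are TYPED
(missing-input Props), NOT attempted; this is not "finishing BSD". Research route `p2` for class
X11b; no claim beyond the stated class; nothing booked; X11b stays CONSTRUCTION-SHAPED. One
definition with a body (`P2SelmerCardBoundAt`, a typed SHAPE — nothing asserted, NOT a named fact)
and theorems; no `sorry`.

## Content

* `P2SelmerCardBoundAt W p` — **(d) as a predicate on `(E, p)`** at route p2's data (the same binders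
  as `P2ControlUpperOnTreeAt`: X11b pair, `p ≥ 5`, surjective `ρ̄`, Heegner field `K`, datum with
  `p ∤ c`, non-torsion Heegner point `P`, every anticyclotomic `κ`, generator `γ`, degree-one `𝔭 ∋ p`):
  `Sel_𝔭(K, E[p^∞])` (`selmerAcBase … 𝔭 ∅`, Castella's `H¹_{ac}(K, E[p^∞])`) is finite and
  `#Sel_𝔭(K, E[p^∞]) ≤ p^a` for some `a ≤ ord_p #Ш(E/K)[p^∞] + 2((ord_p log_ω P − 1) − ord_p[E(K):ℤP]) + ord_p ∏_{w∣p} c_w(E/K)`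
  — the `≤` half of Cas18 (3.2.1) with (calcul) (`#H¹_ac(K,E[p^∞]) = #Ш[p^∞]·[E(K_𝔭)_{/tor}⊗ℤ_p : ℤ_p P]²/[E(K)⊗ℤ_p : ℤ_p P]²`,
  `[E(K_𝔭)_{/tor}⊗ℤ_p : ℤ_p P] = c_p^{(p)}·#ℤ_p/((1/p) log_ω P)/#H⁰(K_𝔭, E[p^∞])`, the `#H⁰` being
  `1` under (iv)); JSW Prop. 3.2.1 (the reciprocity half of Poitou–Tate). PUB shape; nothing asserted.
* **`p2ControlUpperOnTreeAt_of_selmerCardBoundAt`** — at a pair with (iv) `E(ℚ_p)[p] = 0`,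
  `P2SelmerCardBoundAt W p` implies `P2ControlUpperOnTreeAt W p` (this generation: Greenberg's
  bad-place kernels are kernel theorems, `controlUpperOnTreeAt_of_selmerCardBound_above`).
* **`P2.bsdp_of_onTree_weakest_split`** — THE STATEMENT OF RECORD with (T1ᵗ-CTL≤) SPLIT BY (iv): the
  inputs of `P2.bsdp_of_onTree_weakest` (14 published named facts, (T1ᵗ-IMC) `P2OpenInputOnTreeAt`,
  (T2α′), (T2♯-ℝ) `P2ShimuraDisplaysAt`, (T3), (T4′)) with `P2ControlUpperOnTreeAt` demanded only at
  the pairs WITHOUT (iv), and `P2SelmerCardBoundAt` (d) at the pairs WITH (iv). CONDITIONAL; nothing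
  booked; reach, census numbers and labels UNCHANGED (the population is the same; only the shape of
  the control input on the (iv)-part changed from Cas18 Thm. 2.3 `≤` to Cas18 (3.2.1) `≤`).

References: [Castella2018] Thm. 2.3, (3.2.1) and (calcul) in its proof (arXiv:1704.06608 pp. 5–6);
[Castella2018Erratum] Thm. 1.1 (iv); [JetchevSkinnerWan2017] Prop. 3.2.1 (shape only);
[GreenbergLNM1716] §3 Lemma 3.3 (p. 87).
-/

noncomputable section

open scoped Classical

open WeierstrassCurve NumberField IsDedekindDomain Literature.NumberTheory.EllipticCurves
  Literature.NumberTheory.EllipticCurves.ModularForms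
  Literature.NumberTheory.EllipticCurves.Rank1Residual
  Literature.NumberTheory.EllipticCurves.Rank1Residual.Typed
  Literature.NumberTheory.EllipticCurves.Wuthrich2014
  Literature.NumberTheory.EllipticCurves.BalakrishnanEtAl2019
  Literature.NumberTheory.QuadraticFields.Quadratic
  Literature.NumberTheory.Automorphic
  Summit.BirchSwinnertonDyer.Rank1Residual.X11b.AcSelmer

namespace Summit.BirchSwinnertonDyer.Rank1Residual.X11b

/-! ### (d) as a predicate on `(E, p)` -/

/-- **(d) — ONE Selmer cardinality bound, as a predicate on `(E, p)`** at route p2's data (binders of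
`P2ControlUpperOnTreeAt`): for every anticyclotomic `κ`, generator `γ`, degree-one `𝔭 ∋ p` and THE
embedding `embAt`, `Sel_𝔭(K, E[p^∞])` (`selmerAcBase (E_K) p 𝔭 ∅`) is finite with `#Sel_𝔭(K, E[p^∞]) ≤ p^a`
for some `a ≤ ord_p #Ш(E/K)[p^∞] + 2((ord_p log_ω P − 1) − ord_p[E(K):ℤP]) + ord_p ∏_{w∣p} c_w(E/K)`.
The `≤` half of Cas18 (3.2.1) with (calcul) (under (iv) the `#H⁰(K_𝔭, E[p^∞])` factors are `1`);
JSW Prop. 3.2.1. PUB shape; a predicate on `(W, p)`; nothing asserted; NOT a named fact.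
[cite: Castella2018, proof of Thm. 2.3, (3.2.1) and the computation following it (arXiv:1704.06608 pp. 5–6) (shape only; nothing asserted)]
[cite: JetchevSkinnerWan2017, Prop. 3.2.1 (shape only; nothing asserted)] -/
def P2SelmerCardBoundAt (W : WeierstrassCurve ℚ) [W.IsElliptic] [W.IsGloballyMinimal] (p : ℕ)
    [Fact p.Prime] : Prop :=
  ∀ (N : ℕ) [NeZero N] (K : Type) [Field K] [NumberField K]
    (Dt : ModularParametrizationData W N) (H : HeegnerDatum N (NumberField.discr K)) (ι : K →+* ℂ)
    (P : (W.baseChange K).toAffine.Point),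
    ClassX11b W p → 5 ≤ p → Surj W p → W.conductorNorm ℤ = N → IsImaginaryQuadratic K →
    Odd (NumberField.discr K) → ¬ (p : ℤ) ∣ NumberField.discr K → ¬ p ∣ Units.torsionOrder K →
    SatisfiesHeegnerHypothesis N K →
    (W.quadraticTwist (NumberField.discr K : ℚ)).entireLFunction 1 ≠ 0 →
    WeierstrassCurve.Affine.Point.map ι.toRatAlgHom P = heegnerPointComplex Dt H →
    ¬ (p : ℤ) ∣ Dt.c → ¬ IsOfFinAddOrder P →
    ∀ (κ : ZpExtension K p), κ.IsAnticyclotomic →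
      ∀ (γ : Field.absoluteGaloisGroup K) [Fact (κ.IsTopGenerator γ)]
        (𝔭 : HeightOneSpectrum (𝓞 K)) (h𝔭 : ((p : ℕ) : 𝓞 K) ∈ 𝔭.asIdeal)
        (he : 𝔭.asIdeal.ramificationIdx (𝓞 ℚ) = 1) (hf : 𝔭.asIdeal.inertiaDeg (𝓞 ℚ) = 1),
        ∃ (_ : Finite (selmerAcBase (W.baseChange K) p 𝔭 ∅)) (a : ℕ),
          Nat.card (selmerAcBase (W.baseChange K) p 𝔭 ∅) ≤ p ^ a ∧
          (a : ℤ) ≤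
            (padicValNat p (Nat.card (AddCommGroup.primaryComponent (W.baseChange K).sha p)) : ℤ) +
            2 * ((padicLogOrd W p (embAt K p 𝔭 h𝔭 he hf) P - 1) -
              (padicValNat p (AddSubgroup.zmultiples P).index : ℤ)) +
              padicValNat p (tamagawaProductAbove W K p)

/-! ### The control input from (iv) + (d) -/

/-- **(T1ᵗ-CTL≤) at a pair with (iv) from (d).** If `E(ℚ_p)[p] = 0` then `P2SelmerCardBoundAt W p`
implies `P2ControlUpperOnTreeAt W p` — the bad-place kernel bounds of Greenberg's Lemma 3.3 are
theorems (`p2ControlUpperOnTreeAt_of_selmerCardBound_above`). [cite: Castella2018, Thm. 2.3 and its proof (arXiv:1704.06608 pp. 5–6)]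
[cite: Castella2018Erratum, Thm. 1.1 (iv)] -/
theorem p2ControlUpperOnTreeAt_of_selmerCardBoundAt {W : WeierstrassCurve ℚ} [W.IsElliptic]
    [W.IsGloballyMinimal] {p : ℕ} [Fact p.Prime]
    (hiv : ∀ Q : (W.baseChange ℚ_[p]).toAffine.Point, p • Q = 0 → Q = 0)
    (hd : P2SelmerCardBoundAt W p) : P2ControlUpperOnTreeAt W p := by
  intro N _ K _ _ Dt Hg ι P hX hp5 hs hN hK hodd hpd hμ hHN hLt hP hc hPinf κ hκ γ _ 𝔭 h𝔭 he hf
  haveI : IsTotallyComplex K := hK.2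
  obtain ⟨-, -, hmult, -⟩ := id hX
  have hpN : p ∣ W.conductorNorm ℤ := dvd_conductorNorm_of_mult hmult
  have hsplit : SplitsIn K p := hHN p Fact.out (hN ▸ hpN)
  obtain ⟨hfinK, a, ha, hm⟩ :=
    hd N K Dt Hg ι P hX hp5 hs hN hK hodd hpd hμ hHN hLt hP hc hPinf κ hκ γ 𝔭 h𝔭 he hf
  haveI := hfinK
  -- (iv) ⟹ `E(K̄)[p^∞]^{D_𝔭 ⊓ ker κ} = 0`
  obtain ⟨e⟩ := exists_ringHom_adicCompletion_padic_of_degreeOne p 𝔭 h𝔭 he hf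
  have hKv := noPTorsion_baseChange_adicCompletion_of_padic W p 𝔭 e hiv
  have h0 : FixedPoints.addSubgroup ↥(GreenbergSelmer.decomp 𝔭 ⊓ κ.kerSubgroup)
      ((W.baseChange K).geomPrimaryTorsion p) = ⊥ := by
    refine fixedPoints_decomp_inf_kerSubgroup_eq_bot κ (W.baseChange K) 𝔭 fun m hfix hpm ↦
      eq_zero_of_fixed_decomp_of_local (W.baseChange K) p 𝔭 ?_ m hfix hpm
    exact hKv
  exact controlUpperOnTreeAt_of_selmerCardBound_above hK.1 hκ h0 hsplit hpN ha hm

/-! ### The statement of record with the control input split by (iv) -/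

/-- **THE STATEMENT OF RECORD with (T1ᵗ-CTL≤) SPLIT BY (iv).** `P2.bsdp_of_onTree_weakest` with its
typed control input `P2ControlUpperOnTreeAt` (Cas18 Thm. 2.3 `≤`, PUB shape) demanded only at the
pairs where (iv) `E(ℚ_p)[p] = 0` FAILS, and at the pairs with (iv) replaced by
`P2SelmerCardBoundAt` — ONE Selmer cardinality bound (Cas18 (3.2.1)+(calcul) `≤`, PUB shape) — the
anticyclotomic control theorem's other ingredients (Greenberg Lemmas 3.2/3.3 incl. the Tamagawa
bound at the bad places, the counting snake lemma, away descent) being kernel theorems (this sub-cell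
gens 12–14 and the sibling sub-cell gens 10–11). All other inputs as in `P2.bsdp_of_onTree_weakest`
(14 published named facts; (T1ᵗ-IMC) `P2OpenInputOnTreeAt` — THE open input at `p ∥ N`; (T2α′);
(T2♯-ℝ) `P2ShimuraDisplaysAt`; (T3); (T4′)). CONDITIONAL; nothing booked; reach, census numbers and
labels UNCHANGED. [cite: Castella2018, Thm. 2.3, (3.2.1) (arXiv:1704.06608 pp. 5–6), Thm. 3.2 (p. 9)]
[cite: Castella2018Erratum, Thm. 1.1 (iv)] [cite: JetchevSkinnerWan2017, §7.4.1 and Prop. 3.2.1 (shape only)]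
[cite: Wuthrich2014, Prop. 21 (p. 400)] [cite: Skinner2016PacificMC, Thm. C] -/
theorem P2.bsdp_of_onTree_weakest_split
    -- published inputs (named facts of the tree)
    (hGZ : ∀ (N : ℕ) [NeZero N] (W : WeierstrassCurve ℚ) (K : Type) [Field K] [NumberField K],
      gross_zagier N W K)
    (hKo : ∀ (N : ℕ) [NeZero N] (W : WeierstrassCurve ℚ) (K : Type) [Field K] [NumberField K],
      kolyvagin N W K)
    (hB : ∀ (N : ℕ) [NeZero N] (W : WeierstrassCurve ℚ) (K : Type) [Field K] [NumberField K],
      Kolyvagin1990_padicValNat_card_sha_le N W K)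
    (hSk : Skinner2016.thmC_padicValRat_bsd_rank_zero) (hWu : sha_dvd_analyticSha)
    (hGZK : rank_eq_analyticRank_of_analyticRank_le_one) (hmod : hasEntireLFunction_rat)
    (hnf : exists_isNewformOf) (hHL : HoffsteinLuo1997_exists_twist_L_one_ne_zero)
    (hFHs : friedbergHoffstein_exists_heegnerField_split_twist_ne_zero)
    (hMaz : mazur_not_dvd_maninConstant_of_odd) (hNS : integral_neronScaling_of_isGloballyMinimal)
    (hBDMTV : thm12_not_le_normalizer_splitCartan)
    (hFH : friedbergHoffstein_exists_twist_ne_zero_inertAt)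
    -- (T1ᵗ-CTL≤) SPLIT: Cas18 Thm. 2.3 `≤` only where (iv) fails; (d) Cas18 (3.2.1) `≤` where (iv) holds
    (hC₀ : ∀ (W : WeierstrassCurve ℚ) [W.IsElliptic] [W.IsGloballyMinimal] (p : ℕ) [Fact p.Prime],
      ¬ (∀ Q : (W.baseChange ℚ_[p]).toAffine.Point, p • Q = 0 → Q = 0) → P2ControlUpperOnTreeAt W p)
    (hC₁ : ∀ (W : WeierstrassCurve ℚ) [W.IsElliptic] [W.IsGloballyMinimal] (p : ℕ) [Fact p.Prime],
      (∀ Q : (W.baseChange ℚ_[p]).toAffine.Point, p • Q = 0 → Q = 0) → P2SelmerCardBoundAt W p)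
    -- (T1ᵗ-IMC) THE open input
    (hA : ∀ (W : WeierstrassCurve ℚ) [W.IsElliptic] [W.IsGloballyMinimal] (p : ℕ) [Fact p.Prime],
      P2OpenInputOnTreeAt W p)
    -- (T2α′)
    (hUα : ∀ (W : WeierstrassCurve ℚ) [W.IsElliptic] [W.IsGloballyMinimal] (p : ℕ) [Fact p.Prime],
      ClassX11b W p → 5 ≤ p → p ∣ W.tamagawaProduct →
      (¬ Ram W p ∨ (W.HasSplitMultiplicativeReductionAtPrime p ∧
        p ∣ padicValInt p W.minimalDiscriminantInt)) → Typed.MissingUpperBoundAt W p)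
    -- (T2♯-ℝ) the Shimura displays, weakest form
    (hSh : ∀ (W : WeierstrassCurve ℚ) [W.IsElliptic] [W.IsGloballyMinimal] (p : ℕ) [Fact p.Prime],
      ClassX11b W p → 5 ≤ p → P2ShimuraDisplaysAt W p)
    -- (T3)
    (hX11a : ∀ (Wd : WeierstrassCurve ℚ) [Wd.IsElliptic] [Wd.IsGloballyMinimal] (p : ℕ)
      [Fact p.Prime], ClassX11a Wd p → Typed.MissingLowerBoundAt Wd p)
    -- (T4′)
    (hCorner : ∀ (W : WeierstrassCurve ℚ) [W.IsElliptic] [W.IsGloballyMinimal] (p : ℕ)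
      [Fact p.Prime], ClassX11b W p → ¬ Surj W p → (p = 5 ∨ p = 7) →
        p ∣ padicValInt p W.minimalDiscriminantInt → ¬ Ram W p → Typed.MissingPPartAt W p)
    (W : WeierstrassCurve ℚ) [W.IsElliptic] [W.IsGloballyMinimal] (p : ℕ) [Fact p.Prime]
    (hX : ClassX11b W p) (hp5 : 5 ≤ p) : BSDp W p := by
  refine P2.bsdp_of_onTree_weakest hGZ hKo hB hSk hWu hGZK hmod hnf hHL hFHs hMaz hNS hBDMTV hFH
    ?_ hA hUα hSh hX11a hCorner W p hX hp5
  intro W _ _ p _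
  by_cases hiv : ∀ Q : (W.baseChange ℚ_[p]).toAffine.Point, p • Q = 0 → Q = 0
  · exact p2ControlUpperOnTreeAt_of_selmerCardBoundAt hiv (hC₁ W p hiv)
  · exact hC₀ W p hiv

end Summit.BirchSwinnertonDyer.Rank1Residual.X11b

end
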